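import Mathlib
import Summits.Langlands.Langlands.Theorems.SoloBlindCyclicQuotientOrder

/-!
# Index of Frobenius in the Shimura covering group `(ℤ/N)ˣ / μ_g`

Solo side programme O1b (Eisenstein modulus law at level `qN`).  For a prime `N` and
`g ∣ N − 1`, the covering group of the Shimura covering `X₁(N) → X_μ → X₀(N)` of degree
`(N − 1)/g` is `G = (ℤ/N)ˣ / μ_g`, where `μ_g = rootsOfUnity g (ZMod N)` is the unique subgroup of
order `g` of the cyclic group `(ℤ/N)ˣ`.  The level-raised factor of the `q`-new Eisenstein
modulus is the index `[G : ⟨Frob_q⟩]`; this file proves its closed form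

`[G : ⟨q̄⟩] · (ord_N q · g) = (N − 1) · gcd(ord_N q, g)`,

i.e. `[G : ⟨q̄⟩] = (N − 1)·gcd(ord_N q, g) / (g · ord_N q)`, from the abstract cyclic-group
statement `SoloBlindCyclicQuotientOrder.index_zpowers_mk_mul_orderOf` and `|μ_g| = g`.
-/

set_option linter.dupNamespace false

namespace Summit.Langlands.Langlands.Theorems.SoloBlindCoveringIndex

/-- For a prime `N` and `g ∣ N − 1`, the group of `g`-th roots of unity in `ℤ/N` has order `g`. -/
theorem card_rootsOfUnity_zmod (N g : ℕ) [Fact N.Prime] [NeZero g] (hg : g ∣ N - 1) :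
    Nat.card (rootsOfUnity g (ZMod N)) = g := by
  obtain ⟨ζ, hζ⟩ := IsCyclic.exists_generator (α := (ZMod N)ˣ)
  have hord : orderOf ζ = N - 1 := by
    rw [orderOf_eq_card_of_forall_mem_zpowers hζ, Nat.card_eq_fintype_card, ZMod.card_units]
  obtain ⟨m, hm⟩ := hg
  have hpos : 0 < N - 1 := by
    have h2 := (Fact.out : N.Prime).two_le
    omega
  have hζprim : IsPrimitiveRoot ζ (N - 1) := hord ▸ IsPrimitiveRoot.orderOf ζ
  have hprim : IsPrimitiveRoot (ζ ^ m) g := hζprim.pow hpos (by rw [hm, mul_comm])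
  exact hprim.card_rootsOfUnity'

/-- The covering group `(ℤ/N)ˣ / μ_g` has order `(N − 1)/g`, in the form `|G| · g = N − 1`. -/
theorem card_quotient_mul (N g : ℕ) [Fact N.Prime] [NeZero g] (hg : g ∣ N - 1) :
    Nat.card ((ZMod N)ˣ ⧸ rootsOfUnity g (ZMod N)) * g = N - 1 := by
  have h := (rootsOfUnity g (ZMod N)).index_mul_card
  rw [card_rootsOfUnity_zmod N g hg, Nat.card_eq_fintype_card, ZMod.card_units] at h
  exact h

/-- **Frobenius index in the covering group.**  For a prime `N`, `g ∣ N − 1` and a unit `q` of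
`ℤ/N` (the Frobenius at a prime `q ≠ N`), the index of the cyclic subgroup generated by the image
of `q` in `G = (ℤ/N)ˣ / μ_g` satisfies `[G : ⟨q̄⟩] · (ord_N q · g) = (N − 1) · gcd(ord_N q, g)`. -/
theorem index_zpowers_frob_mul (N g : ℕ) [Fact N.Prime] [NeZero g] (hg : g ∣ N - 1)
    (q : (ZMod N)ˣ) :
    (Subgroup.zpowers (q : (ZMod N)ˣ ⧸ rootsOfUnity g (ZMod N))).index * (orderOf q * g)
      = (N - 1) * Nat.gcd (orderOf q) g := by
  have h := SoloBlindCyclicQuotientOrder.index_zpowers_mk_mul_orderOf (rootsOfUnity g (ZMod N)) q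
  rw [card_rootsOfUnity_zmod N g hg] at h
  have hq := card_quotient_mul N g hg
  calc (Subgroup.zpowers (q : (ZMod N)ˣ ⧸ rootsOfUnity g (ZMod N))).index * (orderOf q * g)
      = ((Subgroup.zpowers (q : (ZMod N)ˣ ⧸ rootsOfUnity g (ZMod N))).index * orderOf q) * g := by
        ring
    _ = (Nat.card ((ZMod N)ˣ ⧸ rootsOfUnity g (ZMod N)) * Nat.gcd (orderOf q) g) * g := by rw [h]
    _ = (Nat.card ((ZMod N)ˣ ⧸ rootsOfUnity g (ZMod N)) * g) * Nat.gcd (orderOf q) g := by ring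
    _ = (N - 1) * Nat.gcd (orderOf q) g := by rw [hq]

/-- Division form of `index_zpowers_frob_mul`:
`[G : ⟨q̄⟩] = (N − 1) · gcd(ord_N q, g) / (ord_N q · g)` (exact division). -/
theorem index_zpowers_frob_eq_div (N g : ℕ) [Fact N.Prime] [NeZero g] (hg : g ∣ N - 1)
    (q : (ZMod N)ˣ) :
    (Subgroup.zpowers (q : (ZMod N)ˣ ⧸ rootsOfUnity g (ZMod N))).index
      = (N - 1) * Nat.gcd (orderOf q) g / (orderOf q * g) := by
  have h := index_zpowers_frob_mul N g hg q
  have hpos : 0 < orderOf q * g := Nat.mul_pos (orderOf_pos q) (Nat.pos_of_ne_zero (NeZero.ne g))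
  exact (Nat.div_eq_of_eq_mul_left hpos h.symm).symm

/-- The denominator divides: `ord_N q · g ∣ (N − 1) · gcd(ord_N q, g)`. -/
theorem orderOf_mul_dvd (N g : ℕ) [Fact N.Prime] [NeZero g] (hg : g ∣ N - 1) (q : (ZMod N)ˣ) :
    orderOf q * g ∣ (N - 1) * Nat.gcd (orderOf q) g :=
  Dvd.intro_left _ (index_zpowers_frob_mul N g hg q)

end Summit.Langlands.Langlands.Theorems.SoloBlindCoveringIndex
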